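import Literature.Topology.FourManifolds.InteriorLift
import Literature.Topology.FourManifolds.CobordismAttachmentPasting
import Literature.Topology.FourManifolds.CobordismEndFlattening
import Literature.Topology.FourManifolds.BoundaryGluingConstruction
import Literature.Topology.FourManifolds.GluingUniquenessControlled
import Literature.Topology.FourManifolds.SmoothEmbeddingComp
import Literature.Topology.FourManifolds.BordismMerging
import Literature.Topology.FourManifolds.InteriorConnected
import HarnessLib

/-!
# Uniqueness of the attachment `W ∪_ψ X` relative to the far end (Milnor's Thm. 1.4)

Topic `Literature/Topology/FourManifolds`; a complement to `CobordismAttachment.lean` (which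
vendors the EXISTENCE half of Milnor, *Lectures on the h-cobordism theorem* (1965), §1,
Thm. 1.4 for the triads `(W; ∅, ∂W)`, `(X; M, N)` as the named fact
`exists_cobordismAttachment`, discharged in `CobordismAttachmentProofs.lean`) and to
`GluingUniquenessControlled.lean` (uniqueness of gluings of two compact manifolds along their
whole boundaries into a CLOSED manifold, controlled off the seam).  Everything in this file is
PROVED; no named facts are introduced.

Milnor's Thm. 1.4: the smooth structure on `W ∪_h W′` compatible with the pieces "is unique up
to a diffeomorphism leaving `V₀`, `h(V₁) = V₁′`, and `V₂′` fixed."  Main result here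
(`CobordismAttachment.exists_diffeomorph_eq_jX_near_inr`): **any two witnesses `V₁`, `V₂` of
`W ∪_ψ X` (`CobordismAttachment b X ψ Vᵢ`) are diffeomorphic by a diffeomorphism `θ` which is
`jX₂ ∘ jX₁⁻¹` on the nose on a neighbourhood of the far end `inr N` of `X`** — in particular
`θ` identifies the boundaries `∂V₁ = jX₁ (inr N)`, `∂V₂ = jX₂ (inr N)` through their markings.

## Proof

The closed-manifold uniqueness of the tree (`BoundaryGluingData.nonempty_diffeomorph`,
Hirsch (1976), Ch. 8, Thm. 2.1, in the controlled form of `GluingUniquenessControlled.lean`) is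
transported to attachments as follows.

* Cap the far ends by ONE AND THE SAME manifold: `K = V₁ ∪_N X̄` (`exists_cobordismAttachment_holds`
  applied to `V₁` and the reversed cobordism `X̄` from `N` to `M`), a compact manifold with
  boundary `∂K = jX̄ (inl M) ≅ M` containing a copy `jX̄ (X)` of `X`.
* Glue the INTERIORS of `Vᵢ` and `K` (boundaryless manifolds, `InteriorManifold.lean`) along the
  two copies of the interior of `X` (`doubleGlueData`, an open gluing `SmoothGlueData` of
  `GluingConstruction.lean`): the result `Qᵢ` is a compact Hausdorff manifold without boundary
  containing smoothly embedded copies `jV : Vᵢ → Qᵢ`, `ιK : K → Qᵢ` (`isSmoothEmbedding_jV`,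
  `isSmoothEmbedding_ιK`; the embeddings are `inl`/`inr` on interiors and, near the boundaries,
  the OTHER piece's copy of `X` precomposed with `jX⁻¹` — smoothness needs no compatibility of
  collars because both structures near `∂Vᵢ` come from `X` itself), meeting exactly along the
  copy of `X` (`jV_eq_ιK_iff`).
* Each `Qᵢ` is a gluing of the SAME two pieces `W` and `K` along `∂W ≡_ψ ∂K`
  (`gluingData : BoundaryGluingData b B.boundaryData ψ Qᵢ`), so the controlled uniqueness gives
  `Ψ : Q₁ ≅ Q₂` equal to `ιK₂ ∘ ιK₁⁻¹` off a small neighbourhood of `∂K`, hence equal to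
  `jV₂ ∘ jX₂ ∘ jX₁⁻¹ ∘ jV₁⁻¹` on `jV₁ (jX₁ (U))` for a neighbourhood `U` of `inr N`, and mapping
  `range jV₁` onto `range jV₂`; `θ = jV₂⁻¹ ∘ Ψ ∘ jV₁`.

## Main definitions and results

* `CobordismAttachment.jX_mem_boundary_iff`, `isInteriorPoint_jW`, … — interior/boundary points
  of an attachment.
* `CobordismAttachment.doubleGlueData A B`, `Q A B` — the open gluing of `Int V` and `Int K`
  along `Int X`; `t2Space_Q`, `compactSpace_Q`.
* `CobordismAttachment.jV`, `ιK`, `jV_jX`, `ιK_jX`, `jV_eq_ιK_iff`, `isSmoothEmbedding_jV`,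
  `isSmoothEmbedding_ιK`.
* `CobordismAttachment.gluingData A B : BoundaryGluingData b B.boundaryData ψ (Q A B)`.
* `CobordismAttachment.diffeomorphOfIsEmpty` — `X = ∅`: `jW : W ≅ V`.
* `CobordismAttachment.exists_diffeomorph_eq_jX_near_inr` — **the uniqueness theorem**.

## References

* J. Milnor, *Lectures on the h-cobordism theorem*, Princeton (1965), §1, Thm. 1.4.
  [MilnorHCobordism1965]
* M. W. Hirsch, *Differential Topology*, GTM 33 (1976), Ch. 8 §2, Thm. 2.1. [HirschDT1976]
* A. Kosinski, *Differential Manifolds* (1993), Ch. VI §1, §5. [Kosinski1993]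
-/

open scoped Manifold ContDiff Topology
open Set Function Filter Topology

noncomputable section

namespace Literature.Topology.FourManifolds

universe u

/-- Local notation: `𝔼 n` is the model Euclidean space `EuclideanSpace ℝ (Fin n)`. -/
local notation "𝔼 " n:arg => EuclideanSpace ℝ (Fin n)
/-- Local notation: `ℍ n` is the closed half space `EuclideanHalfSpace n`. -/
local notation "ℍ " n:arg => EuclideanHalfSpace n

namespace CobordismAttachment

/-! ### Interior and boundary points of an attachment -/

section Points

variable {n : ℕ} {W : Type u} [TopologicalSpace W] [ChartedSpace (ℍ (n + 1)) W]
  {M N : Type u} [TopologicalSpace M] [ChartedSpace (𝔼 n) M]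
  [TopologicalSpace N] [ChartedSpace (𝔼 n) N]
  {b : BoundaryData (𝓡∂ (n + 1)) W (𝓡 n)} {X : Cobordism n M N}
  {ψ : b.carrier ≃ₘ⟮𝓡 n, 𝓡 n⟯ M} {V : Type u} [TopologicalSpace V] [ChartedSpace (ℍ (n + 1)) V]
  (A : CobordismAttachment b X ψ V)

/-- A point `jX x` of `V = W ∪_ψ X` is a boundary point of `V` exactly when `x` lies on the far
end of `X` (`∂V = jX (inr N)`). [cite: MilnorHCobordism1965, §1, Thm. 1.4] -/
theorem jX_mem_boundary_iff (x : X.W) : A.jX x ∈ (𝓡∂ (n + 1)).boundary V ↔ x ∈ range X.inr := by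
  rw [← A.range_jX_comp_inr]
  constructor
  · rintro ⟨y, hy⟩
    exact ⟨y, A.injective_jX hy⟩
  · rintro ⟨y, rfl⟩
    exact ⟨y, rfl⟩

/-- `jX x` is an interior point of `V` exactly when `x` is off the far end. [folklore] -/
theorem isInteriorPoint_jX_iff (x : X.W) :
    (𝓡∂ (n + 1)).IsInteriorPoint (A.jX x) ↔ x ∉ range X.inr := by
  rw [← A.jX_mem_boundary_iff x, ← ModelWithCorners.compl_interior, mem_compl_iff, not_not]
  rfl

/-- The piece `W` lies in the interior of `V`. [folklore] -/
theorem isInteriorPoint_jW (w : W) : (𝓡∂ (n + 1)).IsInteriorPoint (A.jW w) := by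
  by_contra h
  have hb : A.jW w ∈ (𝓡∂ (n + 1)).boundary V := by
    rw [← ModelWithCorners.compl_interior, mem_compl_iff]
    exact h
  rw [← A.range_jX_comp_inr] at hb
  obtain ⟨y, hy⟩ := hb
  obtain ⟨z, -, hz⟩ := (A.jW_eq_jX_iff w (X.inr y)).1 hy.symm
  exact Set.disjoint_left.1 X.disjoint_range (mem_range_self (ψ z)) (hz ▸ mem_range_self y)

/-- Interior points of `X` go to interior points of `V`. [folklore] -/
theorem isInteriorPoint_jX_of_isInteriorPoint {x : X.W} (hx : (𝓡∂ (n + 1)).IsInteriorPoint x) :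
    (𝓡∂ (n + 1)).IsInteriorPoint (A.jX x) := by
  rw [A.isInteriorPoint_jX_iff]
  intro h
  have : x ∈ (𝓡∂ (n + 1)).boundary X.W := X.range_inl_union_range_inr ▸ Or.inr h
  rw [← ModelWithCorners.compl_interior] at this
  exact this hx

/-- A point of `X` sent to an interior point of `V` and off the incoming end is an interior point
of `X`. [folklore] -/
theorem isInteriorPoint_of_jX {x : X.W} (h₁ : (𝓡∂ (n + 1)).IsInteriorPoint (A.jX x))
    (h₂ : x ∉ range X.inl) : (𝓡∂ (n + 1)).IsInteriorPoint x := by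
  rw [A.isInteriorPoint_jX_iff] at h₁
  have hx : x ∉ (𝓡∂ (n + 1)).boundary X.W := by
    rw [← X.range_inl_union_range_inr]
    rintro (h | h)
    exacts [h₂ h, h₁ h]
  rwa [← ModelWithCorners.compl_interior, mem_compl_iff, not_not] at hx

/-- The image `jX (Int X)` is open in `V`. [folklore] -/
theorem isOpen_image_jX_interior [CompactSpace W] [CompactSpace M] [T2Space V]
    [IsManifold (𝓡∂ (n + 1)) ∞ X.W] :
    IsOpen (A.jX '' (𝓡∂ (n + 1)).interior X.W) := by
  rw [isOpen_iff_mem_nhds]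
  rintro _ ⟨x, hx, rfl⟩
  have hx' : x ∉ range X.inl := by
    intro h
    have : x ∈ (𝓡∂ (n + 1)).boundary X.W := X.range_inl_union_range_inr ▸ Or.inl h
    rw [← ModelWithCorners.compl_interior] at this
    exact this hx
  exact A.image_jX_mem_nhds hx' (InteriorManifold.isOpen_interior_carrier.mem_nhds hx)

/-- The image under `jX` of an open set off the incoming end is open in `V`. [folklore] -/
theorem isOpen_image_jX_of_subset [CompactSpace W] [CompactSpace M] [T2Space V] {U : Set X.W}
    (hU : IsOpen U) (hUM : Disjoint U (range X.inl)) : IsOpen (A.jX '' U) := by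
  rw [isOpen_iff_mem_nhds]
  rintro _ ⟨x, hx, rfl⟩
  exact A.image_jX_mem_nhds (Set.disjoint_left.1 hUM hx) (hU.mem_nhds hx)

end Points

/-! ### Gluing two attachments of `X` and `X̄` along the interior of `X` -/

section DoubleGlue

variable {n : ℕ} {W : Type u} [TopologicalSpace W] [ChartedSpace (ℍ (n + 1 + 1)) W]
  {C : Type u} [TopologicalSpace C] [ChartedSpace (ℍ (n + 1 + 1)) C]
  {M N : Type u} [TopologicalSpace M] [ChartedSpace (𝔼 (n + 1)) M]
  [TopologicalSpace N] [ChartedSpace (𝔼 (n + 1)) N]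
  {b : BoundaryData (𝓡∂ (n + 1 + 1)) W (𝓡 (n + 1))} {X : Cobordism (n + 1) M N}
  {ψ : b.carrier ≃ₘ⟮𝓡 (n + 1), 𝓡 (n + 1)⟯ M}
  {bC : BoundaryData (𝓡∂ (n + 1 + 1)) C (𝓡 (n + 1))} {ψ' : bC.carrier ≃ₘ⟮𝓡 (n + 1), 𝓡 (n + 1)⟯ N}
  {V : Type u} [TopologicalSpace V] [ChartedSpace (ℍ (n + 1 + 1)) V]
  {K : Type u} [TopologicalSpace K] [ChartedSpace (ℍ (n + 1 + 1)) K]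

/-- The interior of the total space of a cobordism, as an open submanifold. [folklore] -/
def _root_.Literature.Topology.FourManifolds.Cobordism.interiorOpens (X : Cobordism (n + 1) M N) :
    TopologicalSpace.Opens X.W :=
  ⟨(𝓡∂ (n + 1 + 1)).interior X.W, InteriorManifold.isOpen_interior_carrier⟩

/-- Membership in `interiorOpens` (definitional). [folklore] -/
theorem _root_.Literature.Topology.FourManifolds.Cobordism.mem_interiorOpens_iff
    (X : Cobordism (n + 1) M N) {x : X.W} :
    x ∈ X.interiorOpens ↔ (𝓡∂ (n + 1 + 1)).IsInteriorPoint x := Iff.rfl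

/-- The total space of the reversed cobordism is that of the cobordism (an instance to let
`Nonempty` transfer through the reducibility barrier of `Cobordism.symm`). [folklore] -/
instance _root_.Literature.Topology.FourManifolds.Cobordism.nonempty_symm_W
    (X : Cobordism (n + 1) M N) [h : Nonempty X.W] : Nonempty X.symm.W := h

variable (A : CobordismAttachment b X ψ V) (B : CobordismAttachment bC X.symm ψ' K)

/-- Points of the interior of `X` are off both ends. [folklore] -/
theorem _root_.Literature.Topology.FourManifolds.Cobordism.not_mem_range_of_isInteriorPoint
    (X : Cobordism (n + 1) M N) {x : X.W} (hx : (𝓡∂ (n + 1 + 1)).IsInteriorPoint x) :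
    x ∉ range X.inl ∧ x ∉ range X.inr := by
  have : x ∉ (𝓡∂ (n + 1 + 1)).boundary X.W := by
    rw [← ModelWithCorners.compl_interior, mem_compl_iff, not_not]
    exact hx
  rw [← X.range_inl_union_range_inr] at this
  exact ⟨fun h => this (Or.inl h), fun h => this (Or.inr h)⟩

/-- **The interior of `X` embedded in the interior of `V`**: the lift of `jX` restricted to
`Int X`. [folklore] -/
def eV (x : X.interiorOpens) : InteriorManifold (𝓡∂ (n + 1 + 1)) V :=
  InteriorManifold.lift (A.jX ∘ Subtype.val) (fun y => A.isInteriorPoint_jX_of_isInteriorPoint y.2) x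

/-- The underlying point of `eV x` (definitional). [folklore] -/
@[simp] theorem eV_val (x : X.interiorOpens) : (A.eV x).val = A.jX x.val := rfl

/-- **The interior of `X` embedded in the interior of `K`** (`K = C ∪ X̄`). [folklore] -/
def eK (x : X.interiorOpens) : InteriorManifold (𝓡∂ (n + 1 + 1)) K :=
  InteriorManifold.lift (B.jX ∘ Subtype.val)
    (fun y => B.isInteriorPoint_jX_of_isInteriorPoint (X := X.symm) y.2) x

/-- The underlying point of `eK x` (definitional). [folklore] -/
@[simp] theorem eK_val (x : X.interiorOpens) : (B.eK x).val = B.jX x.val := rfl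

/-- `eV` is injective. [folklore] -/
theorem injective_eV : Injective A.eV := fun x y h => by
  apply Subtype.ext
  exact A.injective_jX (congrArg InteriorManifold.val h)

/-- `eK` is injective. [folklore] -/
theorem injective_eK : Injective B.eK := fun x y h => by
  apply Subtype.ext
  exact B.injective_jX (congrArg InteriorManifold.val h)

variable [CompactSpace W] [CompactSpace C] [T2Space V] [T2Space K]

/-- The range of `eV` is open in the interior of `V`. [folklore] -/
theorem isOpen_range_eV : IsOpen (range A.eV) := by
  haveI : CompactSpace M := X.compactSpace_of_inl
  have h : range A.eV = InteriorManifold.val ⁻¹' (A.jX '' (𝓡∂ (n + 1 + 1)).interior X.W) := by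
    ext p
    constructor
    · rintro ⟨x, rfl⟩
      exact ⟨x.val, x.2, rfl⟩
    · rintro ⟨x, hx, hp⟩
      exact ⟨⟨x, hx⟩, InteriorManifold.ext hp⟩
  rw [h]
  exact A.isOpen_image_jX_interior.preimage InteriorManifold.continuous_val

/-- The range of `eK` is open in the interior of `K`. [folklore] -/
theorem isOpen_range_eK : IsOpen (range B.eK) := by
  haveI : CompactSpace N := X.compactSpace_of_inr
  have h : range B.eK = InteriorManifold.val ⁻¹' (B.jX '' (𝓡∂ (n + 1 + 1)).interior X.W) := by
    ext p
    constructor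
    · rintro ⟨x, rfl⟩
      exact ⟨x.val, x.2, rfl⟩
    · rintro ⟨x, hx, hp⟩
      exact ⟨⟨x, hx⟩, InteriorManifold.ext hp⟩
  rw [h]
  exact (B.isOpen_image_jX_interior (X := X.symm)).preimage InteriorManifold.continuous_val

variable [IsManifold (𝓡∂ (n + 1 + 1)) ∞ V] [IsManifold (𝓡∂ (n + 1 + 1)) ∞ K]

omit [CompactSpace W] [CompactSpace C] [T2Space V] [T2Space K] in
/-- `eV` is a smooth embedding. [folklore] -/
theorem isSmoothEmbedding_eV :
    Manifold.IsSmoothEmbedding (𝓡∂ (n + 1 + 1)) 𝓘(ℝ, 𝔼 (n + 1 + 1)) ∞ A.eV := by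
  have h : Manifold.IsSmoothEmbedding (𝓡∂ (n + 1 + 1)) (𝓡∂ (n + 1 + 1)) ∞ (A.jX ∘ Subtype.val) :=
    IsSmoothEmbedding.comp_of_isOpen_range A.isSmoothEmbedding_jX (Manifold.IsSmoothEmbedding.of_opens _)
      (by rw [Subtype.range_val]; exact X.interiorOpens.isOpen)
  exact h.interiorLift _

omit [CompactSpace W] [CompactSpace C] [T2Space V] [T2Space K] in
/-- `eK` is a smooth embedding. [folklore] -/
theorem isSmoothEmbedding_eK :
    Manifold.IsSmoothEmbedding (𝓡∂ (n + 1 + 1)) 𝓘(ℝ, 𝔼 (n + 1 + 1)) ∞ B.eK := by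
  have h : Manifold.IsSmoothEmbedding (𝓡∂ (n + 1 + 1)) (𝓡∂ (n + 1 + 1)) ∞ (B.jX ∘ Subtype.val) :=
    IsSmoothEmbedding.comp_of_isOpen_range B.isSmoothEmbedding_jX (Manifold.IsSmoothEmbedding.of_opens _)
      (by rw [Subtype.range_val]; exact X.interiorOpens.isOpen)
  exact h.interiorLift _

/-- `eV` is an open embedding. [folklore] -/
theorem isOpenEmbedding_eV : IsOpenEmbedding A.eV :=
  ⟨A.isSmoothEmbedding_eV.isEmbedding, A.isOpen_range_eV⟩

/-- `eK` is an open embedding. [folklore] -/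
theorem isOpenEmbedding_eK : IsOpenEmbedding B.eK :=
  ⟨B.isSmoothEmbedding_eK.isEmbedding, B.isOpen_range_eK⟩

variable [Nonempty X.W]

/-- The interior of a nonempty cobordism is nonempty. [folklore] -/
instance nonempty_interiorOpens : Nonempty X.interiorOpens := by
  obtain ⟨x, hx⟩ := Literature.Topology.FourManifolds.interior_nonempty (I := 𝓡∂ (n + 1 + 1)) (M := X.W)
  exact ⟨⟨x, hx⟩⟩

/-- **The gluing datum**: the interiors of `V = W ∪_ψ X` and `K = C ∪ X̄` glued along the
partial diffeomorphism `eV x ↦ eK x` of the two copies of `Int X`. [folklore] -/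
def doubleGlueData : SmoothGlueData 𝓘(ℝ, 𝔼 (n + 1 + 1)) 𝓘(ℝ, 𝔼 (n + 1 + 1))
    (InteriorManifold (𝓡∂ (n + 1 + 1)) V) (InteriorManifold (𝓡∂ (n + 1 + 1)) K) (𝔼 (n + 1 + 1)) where
  glue := (A.isOpenEmbedding_eV.toOpenPartialHomeomorph A.eV).symm ≫ₕ
    B.isOpenEmbedding_eK.toOpenPartialHomeomorph B.eK
  contMDiffOn_glue := by
    have h1 : ContMDiffOn 𝓘(ℝ, 𝔼 (n + 1 + 1)) (𝓡∂ (n + 1 + 1)) ∞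
        (A.isOpenEmbedding_eV.toOpenPartialHomeomorph A.eV).symm (range A.eV) :=
      contMDiffOn_symm_of_isSmoothEmbedding A.isSmoothEmbedding_eV A.isOpenEmbedding_eV
    have h2 : ContMDiff (𝓡∂ (n + 1 + 1)) 𝓘(ℝ, 𝔼 (n + 1 + 1)) ∞
        (B.isOpenEmbedding_eK.toOpenPartialHomeomorph B.eK) := by
      rw [IsOpenEmbedding.toOpenPartialHomeomorph_apply]
      exact B.isSmoothEmbedding_eK.contMDiff
    refine (h2.comp_contMDiffOn h1).mono ?_
    intro p hp
    simp only [OpenPartialHomeomorph.trans_source, OpenPartialHomeomorph.symm_source,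
      IsOpenEmbedding.toOpenPartialHomeomorph_target, mem_inter_iff] at hp
    exact hp.1
  contMDiffOn_glue_symm := by
    have h1 : ContMDiffOn 𝓘(ℝ, 𝔼 (n + 1 + 1)) (𝓡∂ (n + 1 + 1)) ∞
        (B.isOpenEmbedding_eK.toOpenPartialHomeomorph B.eK).symm (range B.eK) :=
      contMDiffOn_symm_of_isSmoothEmbedding B.isSmoothEmbedding_eK B.isOpenEmbedding_eK
    have h2 : ContMDiff (𝓡∂ (n + 1 + 1)) 𝓘(ℝ, 𝔼 (n + 1 + 1)) ∞
        (A.isOpenEmbedding_eV.toOpenPartialHomeomorph A.eV) := by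
      rw [IsOpenEmbedding.toOpenPartialHomeomorph_apply]
      exact A.isSmoothEmbedding_eV.contMDiff
    refine (h2.comp_contMDiffOn h1).mono ?_
    intro p hp
    simp only [OpenPartialHomeomorph.trans_target, OpenPartialHomeomorph.symm_target,
      IsOpenEmbedding.toOpenPartialHomeomorph_target, mem_inter_iff] at hp
    exact hp.1
  linA := ContinuousLinearEquiv.refl ℝ _
  linB := ContinuousLinearEquiv.refl ℝ _

/-- The glued space `Q = Int V ∪_{Int X} Int K`. [folklore] -/
abbrev Q : Type u := (doubleGlueData A B).Glued

/-- The source of the gluing map is the copy of `Int X` in `Int V`. [folklore] -/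
theorem doubleGlueData_source : (doubleGlueData A B).glue.source = range A.eV := by
  simp [doubleGlueData]

/-- The gluing map sends `eV x` to `eK x`. [folklore] -/
theorem doubleGlueData_glue_eV (x : X.interiorOpens) : (doubleGlueData A B).glue (A.eV x) = B.eK x := by
  simp only [doubleGlueData, OpenPartialHomeomorph.trans_apply,
    IsOpenEmbedding.toOpenPartialHomeomorph_apply]
  rw [A.isOpenEmbedding_eV.toOpenPartialHomeomorph_left_inv]

/-- **The two copies of `Int X` are identified**: `inl (eV x) = inr (eK x)`. [folklore] -/
theorem inl_eV (x : X.interiorOpens) :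
    (doubleGlueData A B).inl (A.eV x) = (doubleGlueData A B).inr (B.eK x) := by
  rw [SmoothGlueData.inl_eq_inr_iff, doubleGlueData_source]
  exact ⟨mem_range_self x, doubleGlueData_glue_eV A B x⟩

/-- `inl p = inr q` iff `p = eV x`, `q = eK x` for some `x ∈ Int X`. [folklore] -/
theorem inl_eq_inr_iff' {p : InteriorManifold (𝓡∂ (n + 1 + 1)) V} {q : InteriorManifold (𝓡∂ (n + 1 + 1)) K} :
    (doubleGlueData A B).inl p = (doubleGlueData A B).inr q ↔ ∃ x, p = A.eV x ∧ q = B.eK x := by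
  rw [SmoothGlueData.inl_eq_inr_iff, doubleGlueData_source]
  constructor
  · rintro ⟨⟨x, rfl⟩, h⟩
    exact ⟨x, rfl, by rw [← h, doubleGlueData_glue_eV]⟩
  · rintro ⟨x, rfl, rfl⟩
    exact ⟨mem_range_self x, doubleGlueData_glue_eV A B x⟩

/-- **The glued space is Hausdorff**: the graph of the gluing map is the preimage under
`val × val` of the compact set `{(jX x, jX̄ x)}`, and a point of it with both components interior
comes from `Int X`. [folklore] -/
instance t2Space_Q : T2Space (Q A B) := by
  apply SmoothGlueData.t2Space_of_isClosed_graph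
  have hΓ : IsClosed ((fun x : X.W => (A.jX x, B.jX x)) '' univ) :=
    ((isCompact_univ.image (A.continuous_jX.prodMk B.continuous_jX))).isClosed
  have heq : {p : InteriorManifold (𝓡∂ (n + 1 + 1)) V × InteriorManifold (𝓡∂ (n + 1 + 1)) K |
      p.1 ∈ (doubleGlueData A B).glue.source ∧ (doubleGlueData A B).glue p.1 = p.2} =
      (fun p => (p.1.val, p.2.val)) ⁻¹' ((fun x : X.W => (A.jX x, B.jX x)) '' univ) := by
    ext ⟨p, q⟩
    simp only [mem_setOf_eq, mem_preimage, mem_image, mem_univ, true_and, Prod.mk.injEq]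
    rw [doubleGlueData_source]
    constructor
    · rintro ⟨⟨x, rfl⟩, h⟩
      rw [doubleGlueData_glue_eV] at h
      exact ⟨x.val, rfl, by rw [← h]; rfl⟩
    · rintro ⟨x, hx1, hx2⟩
      have hxr : x ∉ range X.inr := (A.isInteriorPoint_jX_iff x).1 (hx1 ▸ p.property)
      have hxl : x ∉ range X.inl := by
        exact (B.isInteriorPoint_jX_iff (X := X.symm) x).1 (hx2 ▸ q.property)
      have hx : (𝓡∂ (n + 1 + 1)).IsInteriorPoint x := by
        have h' : x ∉ (𝓡∂ (n + 1 + 1)).boundary X.W := by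
          rw [← X.range_inl_union_range_inr]
          rintro (h | h)
          exacts [hxl h, hxr h]
        rwa [← ModelWithCorners.compl_interior, mem_compl_iff, not_not] at h'
      refine ⟨⟨⟨x, hx⟩, InteriorManifold.ext hx1⟩, ?_⟩
      rw [show p = A.eV ⟨x, hx⟩ from InteriorManifold.ext hx1.symm, doubleGlueData_glue_eV]
      exact InteriorManifold.ext hx2
  rw [heq]
  exact hΓ.preimage (InteriorManifold.continuous_val.prodMap InteriorManifold.continuous_val)

end DoubleGlue

/-! ### The pieces `V` and `K` inside the glued space -/

section Pieces

variable {n : ℕ} {W : Type u} [TopologicalSpace W] [ChartedSpace (ℍ (n + 1 + 1)) W]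
  {C : Type u} [TopologicalSpace C] [ChartedSpace (ℍ (n + 1 + 1)) C]
  {M N : Type u} [TopologicalSpace M] [ChartedSpace (𝔼 (n + 1)) M]
  [TopologicalSpace N] [ChartedSpace (𝔼 (n + 1)) N]
  {b : BoundaryData (𝓡∂ (n + 1 + 1)) W (𝓡 (n + 1))} {X : Cobordism (n + 1) M N}
  {ψ : b.carrier ≃ₘ⟮𝓡 (n + 1), 𝓡 (n + 1)⟯ M}
  {bC : BoundaryData (𝓡∂ (n + 1 + 1)) C (𝓡 (n + 1))} {ψ' : bC.carrier ≃ₘ⟮𝓡 (n + 1), 𝓡 (n + 1)⟯ N}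
  {V : Type u} [TopologicalSpace V] [ChartedSpace (ℍ (n + 1 + 1)) V]
  {K : Type u} [TopologicalSpace K] [ChartedSpace (ℍ (n + 1 + 1)) K]
  (A : CobordismAttachment b X ψ V) (B : CobordismAttachment bC X.symm ψ' K)

/-- The inverse of `jX` (a genuine inverse on `range jX`). [folklore] -/
def jXinv [Nonempty X.W] (A : CobordismAttachment b X ψ V) : V → X.W := Function.invFun A.jX

/-- `jXinv (jX x) = x`. [folklore] -/
@[simp] theorem jXinv_jX [Nonempty X.W] (x : X.W) : A.jXinv (A.jX x) = x :=
  Function.leftInverse_invFun A.injective_jX x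

/-- `jX̄ x` is an interior point of `K` for `x` off the incoming end of `X`. [folklore] -/
theorem isInteriorPoint_jX_K {x : X.W} (hx : x ∉ range X.inl) :
    (𝓡∂ (n + 1 + 1)).IsInteriorPoint (B.jX x) :=
  (B.isInteriorPoint_jX_iff (X := X.symm) x).2 hx

/-- `jX x` is an interior point of `V` for `x` off the far end of `X`. [folklore] -/
theorem isInteriorPoint_jX_V {x : X.W} (hx : x ∉ range X.inr) :
    (𝓡∂ (n + 1 + 1)).IsInteriorPoint (A.jX x) :=
  (A.isInteriorPoint_jX_iff x).2 hx

/-- A non-interior point of `V` is `jX (inr y)`. [folklore] -/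
theorem exists_eq_jX_inr_of_not {v : V} (hv : ¬ (𝓡∂ (n + 1 + 1)).IsInteriorPoint v) :
    ∃ y, v = A.jX (X.inr y) := by
  have hb : v ∈ (𝓡∂ (n + 1 + 1)).boundary V := by
    rw [← ModelWithCorners.compl_interior]; exact hv
  rw [← A.range_jX_comp_inr] at hb
  obtain ⟨y, rfl⟩ := hb
  exact ⟨y, rfl⟩

/-- A non-interior point of `K` is `jX̄ (inl y)`. [folklore] -/
theorem exists_eq_jX_inl_of_not {k : K} (hk : ¬ (𝓡∂ (n + 1 + 1)).IsInteriorPoint k) :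
    ∃ y, k = B.jX (X.inl y) := by
  have hb : k ∈ (𝓡∂ (n + 1 + 1)).boundary K := by
    rw [← ModelWithCorners.compl_interior]; exact hk
  rw [← B.range_jX_comp_inr] at hb
  obtain ⟨y, rfl⟩ := hb
  exact ⟨y, rfl⟩

/-- `inr N` misses `inl M`. [folklore] -/
theorem _root_.Literature.Topology.FourManifolds.Cobordism.inr_not_mem_range_inl
    (X : Cobordism (n + 1) M N) (y : N) : X.inr y ∉ range X.inl := fun h =>
  Set.disjoint_left.1 X.disjoint_range h (mem_range_self y)

/-- `inl M` misses `inr N`. [folklore] -/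
theorem _root_.Literature.Topology.FourManifolds.Cobordism.inl_not_mem_range_inr
    (X : Cobordism (n + 1) M N) (y : M) : X.inl y ∉ range X.inr := fun h =>
  Set.disjoint_left.1 X.disjoint_range (mem_range_self y) h

/-- The part of `X` off the incoming end, an open submanifold. [folklore] -/
def _root_.Literature.Topology.FourManifolds.Cobordism.offInl (X : Cobordism (n + 1) M N) :
    TopologicalSpace.Opens X.W :=
  ⟨(range X.inl)ᶜ, X.isClosed_range_inl.isOpen_compl⟩

/-- The part of `X` off the far end, an open submanifold. [folklore] -/
def _root_.Literature.Topology.FourManifolds.Cobordism.offInr (X : Cobordism (n + 1) M N) :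
    TopologicalSpace.Opens X.W :=
  ⟨(range X.inr)ᶜ, X.symm.isClosed_range_inl.isOpen_compl⟩

/-- `jX` restricted to `X - inl M`. [folklore] -/
def eXV (y : X.offInl) : V := A.jX y.val

/-- `jX̄` restricted to `X - inr N`. [folklore] -/
def eXK (y : X.offInr) : K := B.jX y.val

/-- `jX` restricted to `X - inl M` is a smooth embedding. [folklore] -/
theorem isSmoothEmbedding_eXV [IsManifold (𝓡∂ (n + 1 + 1)) ∞ V] :
    Manifold.IsSmoothEmbedding (𝓡∂ (n + 1 + 1)) (𝓡∂ (n + 1 + 1)) ∞ (eXV A) := by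
  have hval : Manifold.IsSmoothEmbedding (𝓡∂ (n + 1 + 1)) (𝓡∂ (n + 1 + 1)) ∞
      (Subtype.val : X.offInl → X.W) := Manifold.IsSmoothEmbedding.of_opens _
  have ho : IsOpen (range (Subtype.val : X.offInl → X.W)) := by
    rw [Subtype.range_coe_subtype]; exact X.offInl.isOpen
  exact IsSmoothEmbedding.comp_of_isOpen_range A.isSmoothEmbedding_jX hval ho

/-- `jX̄` restricted to `X - inr N` is a smooth embedding. [folklore] -/
theorem isSmoothEmbedding_eXK [IsManifold (𝓡∂ (n + 1 + 1)) ∞ K] :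
    Manifold.IsSmoothEmbedding (𝓡∂ (n + 1 + 1)) (𝓡∂ (n + 1 + 1)) ∞ (eXK B) := by
  have hB : Manifold.IsSmoothEmbedding (𝓡∂ (n + 1 + 1)) (𝓡∂ (n + 1 + 1)) ∞
      (fun x : X.W => B.jX x) := B.isSmoothEmbedding_jX
  have hval : Manifold.IsSmoothEmbedding (𝓡∂ (n + 1 + 1)) (𝓡∂ (n + 1 + 1)) ∞
      (Subtype.val : X.offInr → X.W) := Manifold.IsSmoothEmbedding.of_opens _
  have ho : IsOpen (range (Subtype.val : X.offInr → X.W)) := by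
    rw [Subtype.range_coe_subtype]; exact X.offInr.isOpen
  exact IsSmoothEmbedding.comp_of_isOpen_range hB hval ho

/-- The range of `eXV`. [folklore] -/
theorem range_eXV : range (eXV A) = A.jX '' (range X.inl)ᶜ := by
  ext v
  constructor
  · rintro ⟨y, rfl⟩
    exact ⟨y.val, y.2, rfl⟩
  · rintro ⟨x, hx, rfl⟩
    exact ⟨⟨x, hx⟩, rfl⟩

/-- The range of `eXK`. [folklore] -/
theorem range_eXK : range (eXK B) = B.jX '' (range X.inr)ᶜ := by
  ext k
  constructor
  · rintro ⟨y, rfl⟩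
    exact ⟨y.val, y.2, rfl⟩
  · rintro ⟨x, hx, rfl⟩
    exact ⟨⟨x, hx⟩, rfl⟩

/-- `eXV` is an open embedding. [folklore] -/
theorem isOpenEmbedding_eXV [CompactSpace W] [T2Space V] : IsOpenEmbedding (eXV A) := by
  haveI : CompactSpace M := X.compactSpace_of_inl
  refine ⟨A.isSmoothEmbedding_jX.isEmbedding.comp IsEmbedding.subtypeVal, ?_⟩
  rw [range_eXV]
  exact A.isOpen_image_jX_of_subset X.isClosed_range_inl.isOpen_compl disjoint_compl_left

/-- `eXK` is an open embedding. [folklore] -/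
theorem isOpenEmbedding_eXK [CompactSpace C] [T2Space K] : IsOpenEmbedding (eXK B) := by
  haveI : CompactSpace N := X.compactSpace_of_inr
  refine ⟨B.isSmoothEmbedding_jX.isEmbedding.comp IsEmbedding.subtypeVal, ?_⟩
  rw [range_eXK]
  exact B.isOpen_image_jX_of_subset (X := X.symm) X.symm.isClosed_range_inl.isOpen_compl
    disjoint_compl_left

variable [CompactSpace W] [CompactSpace C] [T2Space V] [T2Space K]
  [IsManifold (𝓡∂ (n + 1 + 1)) ∞ V] [IsManifold (𝓡∂ (n + 1 + 1)) ∞ K] [Nonempty X.W]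

/-- A base point of the interior of `V`. [folklore] -/
def ptV : InteriorManifold (𝓡∂ (n + 1 + 1)) V := A.eV (Classical.arbitrary _)

/-- A base point of the interior of `K`. [folklore] -/
def ptK : InteriorManifold (𝓡∂ (n + 1 + 1)) K := B.eK (Classical.arbitrary _)

/-- **The embedding of `V` into the glued space `Q`**: `inl` on the interior of `V`, and
`jX x ↦ inr (jX̄ x)` near the boundary `∂V = jX (inr N)`. [folklore] -/
def jV (v : V) : Q A B :=
  haveI := Classical.propDecidable
  if (𝓡∂ (n + 1 + 1)).IsInteriorPoint v then (doubleGlueData A B).inl (InteriorManifold.ofPt A.ptV v)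
  else (doubleGlueData A B).inr (InteriorManifold.ofPt B.ptK (B.jX (A.jXinv v)))

/-- **The embedding of `K` into the glued space `Q`**: `inr` on the interior of `K`, and
`jX̄ x ↦ inl (jX x)` near the boundary `∂K = jX̄ (inl M)`. [folklore] -/
def ιK (k : K) : Q A B :=
  haveI := Classical.propDecidable
  if (𝓡∂ (n + 1 + 1)).IsInteriorPoint k then (doubleGlueData A B).inr (InteriorManifold.ofPt B.ptK k)
  else (doubleGlueData A B).inl (InteriorManifold.ofPt A.ptV (A.jX (jXinv (X := X.symm) B k)))

/-- `jV` on interior points. [folklore] -/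
theorem jV_of_isInteriorPoint {v : V} (hv : (𝓡∂ (n + 1 + 1)).IsInteriorPoint v) :
    jV A B v = (doubleGlueData A B).inl ⟨v, hv⟩ := by
  rw [jV, if_pos hv, InteriorManifold.ofPt_of_isInteriorPoint _ hv]

/-- `ιK` on interior points. [folklore] -/
theorem ιK_of_isInteriorPoint {k : K} (hk : (𝓡∂ (n + 1 + 1)).IsInteriorPoint k) :
    ιK A B k = (doubleGlueData A B).inr ⟨k, hk⟩ := by
  rw [ιK, if_pos hk, InteriorManifold.ofPt_of_isInteriorPoint _ hk]

/-- **`jV` on the copy of `X`, off the incoming end**: `jV (jX x) = inr (jX̄ x)`. [folklore] -/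
theorem jV_jX {x : X.W} (hx : x ∉ range X.inl) :
    jV A B (A.jX x) = (doubleGlueData A B).inr ⟨B.jX x, isInteriorPoint_jX_K B hx⟩ := by
  by_cases h : (𝓡∂ (n + 1 + 1)).IsInteriorPoint (A.jX x)
  · rw [jV_of_isInteriorPoint A B h]
    have hx' : (𝓡∂ (n + 1 + 1)).IsInteriorPoint x := A.isInteriorPoint_of_jX h hx
    exact inl_eV A B ⟨x, hx'⟩
  · rw [jV, if_neg h, jXinv_jX A,
      InteriorManifold.ofPt_of_isInteriorPoint _ (isInteriorPoint_jX_K B hx)]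

/-- **`ιK` on the copy of `X`, off the far end**: `ιK (jX̄ x) = inl (jX x)`. [folklore] -/
theorem ιK_jX {x : X.W} (hx : x ∉ range X.inr) :
    ιK A B (B.jX x) = (doubleGlueData A B).inl ⟨A.jX x, isInteriorPoint_jX_V A hx⟩ := by
  by_cases h : (𝓡∂ (n + 1 + 1)).IsInteriorPoint (B.jX x)
  · rw [ιK_of_isInteriorPoint A B h]
    have hx' : (𝓡∂ (n + 1 + 1)).IsInteriorPoint x :=
      B.isInteriorPoint_of_jX (X := X.symm) h hx
    exact (inl_eV A B ⟨x, hx'⟩).symm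
  · rw [ιK, if_neg h, jXinv_jX B,
      InteriorManifold.ofPt_of_isInteriorPoint _ (isInteriorPoint_jX_V A hx)]

/-- **The two copies of `X` agree in `Q`**: `jV (jX x) = ιK (jX̄ x)` for every `x`. [folklore] -/
theorem jV_jX_eq_ιK_jX (x : X.W) : jV A B (A.jX x) = ιK A B (B.jX x) := by
  by_cases hx : x ∈ range X.inl
  · have hxr : x ∉ range X.inr := fun h => Set.disjoint_left.1 X.disjoint_range hx h
    rw [ιK_jX A B hxr, jV_of_isInteriorPoint A B (isInteriorPoint_jX_V A hxr)]
  · rw [jV_jX A B hx, ιK_of_isInteriorPoint A B (isInteriorPoint_jX_K B hx)]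

/-- `jV` on the piece `W`. [folklore] -/
theorem jV_jW (w : W) :
    jV A B (A.jW w) = (doubleGlueData A B).inl ⟨A.jW w, A.isInteriorPoint_jW w⟩ :=
  jV_of_isInteriorPoint A B _

/-- `ιK` on the piece `C`. [folklore] -/
theorem ιK_jW (c : C) :
    ιK A B (B.jW c) = (doubleGlueData A B).inr ⟨B.jW c, B.isInteriorPoint_jW c⟩ :=
  ιK_of_isInteriorPoint A B _

/-- **`jV` is injective.** [folklore] -/
theorem injective_jV : Injective (jV A B) := by
  intro v₁ v₂ h
  by_cases h₁ : (𝓡∂ (n + 1 + 1)).IsInteriorPoint v₁ <;>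
    by_cases h₂ : (𝓡∂ (n + 1 + 1)).IsInteriorPoint v₂
  · rw [jV_of_isInteriorPoint A B h₁, jV_of_isInteriorPoint A B h₂] at h
    exact congrArg InteriorManifold.val ((doubleGlueData A B).inl_injective h)
  · obtain ⟨y, rfl⟩ := exists_eq_jX_inr_of_not A h₂
    rw [jV_of_isInteriorPoint A B h₁, jV_jX A B (X.inr_not_mem_range_inl y), inl_eq_inr_iff'] at h
    obtain ⟨x, hx1, hx2⟩ := h
    have : X.inr y = x.val := B.injective_jX (congrArg InteriorManifold.val hx2)
    rw [this]
    exact congrArg InteriorManifold.val hx1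
  · obtain ⟨y, rfl⟩ := exists_eq_jX_inr_of_not A h₁
    rw [jV_of_isInteriorPoint A B h₂, jV_jX A B (X.inr_not_mem_range_inl y), eq_comm,
      inl_eq_inr_iff'] at h
    obtain ⟨x, hx1, hx2⟩ := h
    have : X.inr y = x.val := B.injective_jX (congrArg InteriorManifold.val hx2)
    rw [this]
    exact (congrArg InteriorManifold.val hx1).symm
  · obtain ⟨y₁, rfl⟩ := exists_eq_jX_inr_of_not A h₁
    obtain ⟨y₂, rfl⟩ := exists_eq_jX_inr_of_not A h₂
    rw [jV_jX A B (X.inr_not_mem_range_inl y₁), jV_jX A B (X.inr_not_mem_range_inl y₂)] at h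
    have := congrArg InteriorManifold.val ((doubleGlueData A B).inr_injective h)
    rw [B.injective_jX this]

/-- **`ιK` is injective.** [folklore] -/
theorem injective_ιK : Injective (ιK A B) := by
  intro k₁ k₂ h
  by_cases h₁ : (𝓡∂ (n + 1 + 1)).IsInteriorPoint k₁ <;>
    by_cases h₂ : (𝓡∂ (n + 1 + 1)).IsInteriorPoint k₂
  · rw [ιK_of_isInteriorPoint A B h₁, ιK_of_isInteriorPoint A B h₂] at h
    exact congrArg InteriorManifold.val ((doubleGlueData A B).inr_injective h)
  · obtain ⟨y, rfl⟩ := exists_eq_jX_inl_of_not B h₂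
    rw [ιK_of_isInteriorPoint A B h₁, ιK_jX A B (X.inl_not_mem_range_inr y), eq_comm,
      inl_eq_inr_iff'] at h
    obtain ⟨x, hx1, hx2⟩ := h
    have : X.inl y = x.val := A.injective_jX (congrArg InteriorManifold.val hx1)
    rw [this]
    exact congrArg InteriorManifold.val hx2
  · obtain ⟨y, rfl⟩ := exists_eq_jX_inl_of_not B h₁
    rw [ιK_of_isInteriorPoint A B h₂, ιK_jX A B (X.inl_not_mem_range_inr y), inl_eq_inr_iff'] at h
    obtain ⟨x, hx1, hx2⟩ := h
    have : X.inl y = x.val := A.injective_jX (congrArg InteriorManifold.val hx1)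
    rw [this]
    exact (congrArg InteriorManifold.val hx2).symm
  · obtain ⟨y₁, rfl⟩ := exists_eq_jX_inl_of_not B h₁
    obtain ⟨y₂, rfl⟩ := exists_eq_jX_inl_of_not B h₂
    rw [ιK_jX A B (X.inl_not_mem_range_inr y₁), ιK_jX A B (X.inl_not_mem_range_inr y₂)] at h
    have := congrArg InteriorManifold.val ((doubleGlueData A B).inl_injective h)
    rw [A.injective_jX this]

/-- **The two pieces cover `Q`.** [folklore] -/
theorem range_jV_union_range_ιK : range (jV A B) ∪ range (ιK A B) = univ := by
  refine eq_univ_of_forall fun q => ?_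
  rcases (doubleGlueData A B).exists_inl_or_inr q with ⟨p, rfl⟩ | ⟨p, rfl⟩
  · exact Or.inl ⟨p.val, jV_of_isInteriorPoint A B p.property⟩
  · exact Or.inr ⟨p.val, ιK_of_isInteriorPoint A B p.property⟩

/-- **The two pieces meet exactly along the copy of `X`**: `jV v = ιK k` iff `v = jX x` and
`k = jX̄ x` for some `x`. [folklore] -/
theorem jV_eq_ιK_iff {v : V} {k : K} : jV A B v = ιK A B k ↔ ∃ x, v = A.jX x ∧ k = B.jX x := by
  constructor
  · intro h
    by_cases hv : (𝓡∂ (n + 1 + 1)).IsInteriorPoint v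
    · by_cases hk : (𝓡∂ (n + 1 + 1)).IsInteriorPoint k
      · rw [jV_of_isInteriorPoint A B hv, ιK_of_isInteriorPoint A B hk, inl_eq_inr_iff'] at h
        obtain ⟨x, hx1, hx2⟩ := h
        exact ⟨x.val, congrArg InteriorManifold.val hx1, congrArg InteriorManifold.val hx2⟩
      · obtain ⟨y, rfl⟩ := exists_eq_jX_inl_of_not B hk
        rw [jV_of_isInteriorPoint A B hv, ιK_jX A B (X.inl_not_mem_range_inr y)] at h
        exact ⟨X.inl y, congrArg InteriorManifold.val ((doubleGlueData A B).inl_injective h), rfl⟩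
    · obtain ⟨y, rfl⟩ := exists_eq_jX_inr_of_not A hv
      refine ⟨X.inr y, rfl, ?_⟩
      rw [jV_jX_eq_ιK_jX] at h
      exact (injective_ιK A B h).symm
  · rintro ⟨x, rfl, rfl⟩
    exact jV_jX_eq_ιK_jX A B x

/-! #### `jV` and `ιK` are smooth embeddings -/

/-- The `K`-side model of `jV` near the boundary: `inr ∘ (lift of jX̄)` on `X - inl M`. [folklore] -/
def fK (y : X.offInl) : Q A B :=
  (doubleGlueData A B).inr (InteriorManifold.lift (fun y : X.offInl => B.jX y.val)
    (fun y : X.offInl => isInteriorPoint_jX_K B y.2) y)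

/-- The `V`-side model of `ιK` near the boundary: `inl ∘ (lift of jX)` on `X - inr N`. [folklore] -/
def fV (y : X.offInr) : Q A B :=
  (doubleGlueData A B).inl (InteriorManifold.lift (fun y : X.offInr => A.jX y.val)
    (fun y : X.offInr => isInteriorPoint_jX_V A y.2) y)

/-- `fK` is a smooth embedding. [folklore] -/
theorem isSmoothEmbedding_fK :
    Manifold.IsSmoothEmbedding (𝓡∂ (n + 1 + 1)) 𝓘(ℝ, 𝔼 (n + 1 + 1)) ∞ (fK A B) := by
  have hB : Manifold.IsSmoothEmbedding (𝓡∂ (n + 1 + 1)) (𝓡∂ (n + 1 + 1)) ∞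
      (fun x : X.W => B.jX x) := B.isSmoothEmbedding_jX
  have hval : Manifold.IsSmoothEmbedding (𝓡∂ (n + 1 + 1)) (𝓡∂ (n + 1 + 1)) ∞
      (Subtype.val : X.offInl → X.W) := Manifold.IsSmoothEmbedding.of_opens _
  have ho : IsOpen (range (Subtype.val : X.offInl → X.W)) := by
    rw [Subtype.range_coe_subtype]; exact X.offInl.isOpen
  have h : Manifold.IsSmoothEmbedding (𝓡∂ (n + 1 + 1)) (𝓡∂ (n + 1 + 1)) ∞
      (fun y : X.offInl => B.jX y.val) := IsSmoothEmbedding.comp_of_isOpen_range hB hval ho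
  exact (doubleGlueData A B).isSmoothEmbedding_inr_comp (h.interiorLift _)

/-- `fV` is a smooth embedding. [folklore] -/
theorem isSmoothEmbedding_fV :
    Manifold.IsSmoothEmbedding (𝓡∂ (n + 1 + 1)) 𝓘(ℝ, 𝔼 (n + 1 + 1)) ∞ (fV A B) := by
  have hval : Manifold.IsSmoothEmbedding (𝓡∂ (n + 1 + 1)) (𝓡∂ (n + 1 + 1)) ∞
      (Subtype.val : X.offInr → X.W) := Manifold.IsSmoothEmbedding.of_opens _
  have ho : IsOpen (range (Subtype.val : X.offInr → X.W)) := by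
    rw [Subtype.range_coe_subtype]; exact X.offInr.isOpen
  have h : Manifold.IsSmoothEmbedding (𝓡∂ (n + 1 + 1)) (𝓡∂ (n + 1 + 1)) ∞
      (fun y : X.offInr => A.jX y.val) :=
    IsSmoothEmbedding.comp_of_isOpen_range A.isSmoothEmbedding_jX hval ho
  exact (doubleGlueData A B).isSmoothEmbedding_inl_comp (h.interiorLift _)

/-- **`jV` is an immersion at every point** (complement `PUnit`): on the interior of `V` it is
`inl ∘ ofPt`; on the open set `jX (X - inl M) ⊇ ∂V` it is `fK ∘ (jX|)⁻¹`, an embedding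
precomposed with a partial diffeomorphism. [folklore] -/
theorem isImmersionAtOfComplement_jV (v : V) :
    Manifold.IsImmersionAtOfComplement PUnit.{1} (𝓡∂ (n + 1 + 1)) 𝓘(ℝ, 𝔼 (n + 1 + 1)) ∞
      (jV A B) v := by
  by_cases hv : (𝓡∂ (n + 1 + 1)).IsInteriorPoint v
  · have h0 : Manifold.IsImmersionAtOfComplement PUnit.{1} (𝓡∂ (n + 1 + 1)) 𝓘(ℝ, 𝔼 (n + 1 + 1)) ∞
        (InteriorManifold.ofPt A.ptV) v :=
      InteriorManifold.isImmersionAtOfComplement_of_val_eq (g := InteriorManifold.ofPt A.ptV)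
        (fun m hm => InteriorManifold.ofPt_val_of_isInteriorPoint A.ptV hm) ⟨v, hv⟩
    have h1 := (doubleGlueData A B).isImmersionAtOfComplement_inl_comp h0
    refine h1.congr_of_eventuallyEq ?_
    filter_upwards [InteriorManifold.isOpen_interior_carrier.mem_nhds hv] with v' hv'
    show (doubleGlueData A B).inl (InteriorManifold.ofPt A.ptV v') = jV A B v'
    rw [InteriorManifold.ofPt_of_isInteriorPoint _ hv', jV_of_isInteriorPoint A B hv']
  · obtain ⟨y, rfl⟩ := exists_eq_jX_inr_of_not A hv
    haveI : Nonempty X.offInl := ⟨⟨X.inr y, X.inr_not_mem_range_inl y⟩⟩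
    set Φ := (isOpenEmbedding_eXV A).toOpenPartialHomeomorph (eXV A) with hΦ
    have hΦt : Φ.symm.source = range (eXV A) := by
      rw [OpenPartialHomeomorph.symm_source, hΦ, IsOpenEmbedding.toOpenPartialHomeomorph_target]
    have hΦs : ContMDiffOn (𝓡∂ (n + 1 + 1)) (𝓡∂ (n + 1 + 1)) ∞ Φ.symm Φ.symm.source := by
      rw [hΦt, hΦ]
      exact contMDiffOn_symm_of_isSmoothEmbedding (isSmoothEmbedding_eXV A) (isOpenEmbedding_eXV A)
    have hΦs' : ContMDiffOn (𝓡∂ (n + 1 + 1)) (𝓡∂ (n + 1 + 1)) ∞ Φ.symm.symm Φ.symm.target := by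
      rw [OpenPartialHomeomorph.symm_symm, OpenPartialHomeomorph.symm_target, hΦ,
        IsOpenEmbedding.toOpenPartialHomeomorph_apply]
      exact (isSmoothEmbedding_eXV A).contMDiff.contMDiffOn
    have hmem : A.jX (X.inr y) ∈ Φ.symm.source := by
      rw [hΦt]
      exact ⟨⟨X.inr y, X.inr_not_mem_range_inl y⟩, rfl⟩
    have h0 : Manifold.IsImmersionAtOfComplement PUnit.{1} (𝓡∂ (n + 1 + 1)) 𝓘(ℝ, 𝔼 (n + 1 + 1)) ∞
        (fK A B) (Φ.symm (A.jX (X.inr y))) :=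
      (isSmoothEmbedding_fK A B).isImmersionAtOfComplement_punit rfl _
    have h1 := h0.comp_openPartialHomeomorph Φ.symm hΦs hΦs' hmem
    refine h1.congr_of_eventuallyEq ?_
    filter_upwards [Φ.symm.open_source.mem_nhds hmem] with v' hv'
    rw [hΦt] at hv'
    obtain ⟨z, rfl⟩ := hv'
    show fK A B (Φ.symm (eXV A z)) = jV A B (eXV A z)
    rw [hΦ, (isOpenEmbedding_eXV A).toOpenPartialHomeomorph_left_inv]
    show (doubleGlueData A B).inr _ = jV A B (A.jX z.val)
    rw [jV_jX A B z.2]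
    rfl

/-- **`ιK` is an immersion at every point** (complement `PUnit`). [folklore] -/
theorem isImmersionAtOfComplement_ιK (k : K) :
    Manifold.IsImmersionAtOfComplement PUnit.{1} (𝓡∂ (n + 1 + 1)) 𝓘(ℝ, 𝔼 (n + 1 + 1)) ∞
      (ιK A B) k := by
  by_cases hk : (𝓡∂ (n + 1 + 1)).IsInteriorPoint k
  · have h0 : Manifold.IsImmersionAtOfComplement PUnit.{1} (𝓡∂ (n + 1 + 1)) 𝓘(ℝ, 𝔼 (n + 1 + 1)) ∞
        (InteriorManifold.ofPt B.ptK) k :=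
      InteriorManifold.isImmersionAtOfComplement_of_val_eq (g := InteriorManifold.ofPt B.ptK)
        (fun m hm => InteriorManifold.ofPt_val_of_isInteriorPoint B.ptK hm) ⟨k, hk⟩
    have h1 := (doubleGlueData A B).isImmersionAtOfComplement_inr_comp h0
    refine h1.congr_of_eventuallyEq ?_
    filter_upwards [InteriorManifold.isOpen_interior_carrier.mem_nhds hk] with k' hk'
    show (doubleGlueData A B).inr (InteriorManifold.ofPt B.ptK k') = ιK A B k'
    rw [InteriorManifold.ofPt_of_isInteriorPoint _ hk', ιK_of_isInteriorPoint A B hk']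
  · obtain ⟨y, rfl⟩ := exists_eq_jX_inl_of_not B hk
    haveI : Nonempty X.offInr := ⟨⟨X.inl y, X.inl_not_mem_range_inr y⟩⟩
    set Φ := (isOpenEmbedding_eXK B).toOpenPartialHomeomorph (eXK B) with hΦ
    have hΦt : Φ.symm.source = range (eXK B) := by
      rw [OpenPartialHomeomorph.symm_source, hΦ, IsOpenEmbedding.toOpenPartialHomeomorph_target]
    have hΦs : ContMDiffOn (𝓡∂ (n + 1 + 1)) (𝓡∂ (n + 1 + 1)) ∞ Φ.symm Φ.symm.source := by
      rw [hΦt, hΦ]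
      exact contMDiffOn_symm_of_isSmoothEmbedding (isSmoothEmbedding_eXK B) (isOpenEmbedding_eXK B)
    have hΦs' : ContMDiffOn (𝓡∂ (n + 1 + 1)) (𝓡∂ (n + 1 + 1)) ∞ Φ.symm.symm Φ.symm.target := by
      rw [OpenPartialHomeomorph.symm_symm, OpenPartialHomeomorph.symm_target, hΦ,
        IsOpenEmbedding.toOpenPartialHomeomorph_apply]
      exact (isSmoothEmbedding_eXK B).contMDiff.contMDiffOn
    have hmem : B.jX (X.inl y) ∈ Φ.symm.source := by
      rw [hΦt]
      exact ⟨⟨X.inl y, X.inl_not_mem_range_inr y⟩, rfl⟩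
    have h0 : Manifold.IsImmersionAtOfComplement PUnit.{1} (𝓡∂ (n + 1 + 1)) 𝓘(ℝ, 𝔼 (n + 1 + 1)) ∞
        (fV A B) (Φ.symm (B.jX (X.inl y))) :=
      (isSmoothEmbedding_fV A B).isImmersionAtOfComplement_punit rfl _
    have h1 := h0.comp_openPartialHomeomorph Φ.symm hΦs hΦs' hmem
    refine h1.congr_of_eventuallyEq ?_
    filter_upwards [Φ.symm.open_source.mem_nhds hmem] with k' hk'
    rw [hΦt] at hk'
    obtain ⟨z, rfl⟩ := hk'
    show fV A B (Φ.symm (eXK B z)) = ιK A B (eXK B z)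
    rw [hΦ, (isOpenEmbedding_eXK B).toOpenPartialHomeomorph_left_inv]
    show (doubleGlueData A B).inl _ = ιK A B (B.jX z.val)
    rw [ιK_jX A B z.2]
    rfl

/-- `jV` is `C^∞`. [folklore] -/
theorem contMDiff_jV : ContMDiff (𝓡∂ (n + 1 + 1)) 𝓘(ℝ, 𝔼 (n + 1 + 1)) ∞ (jV A B) := fun v =>
  (isImmersionAtOfComplement_jV A B v).contMDiffAt

/-- `ιK` is `C^∞`. [folklore] -/
theorem contMDiff_ιK : ContMDiff (𝓡∂ (n + 1 + 1)) 𝓘(ℝ, 𝔼 (n + 1 + 1)) ∞ (ιK A B) := fun k =>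
  (isImmersionAtOfComplement_ιK A B k).contMDiffAt

/-- `jV` is continuous. [folklore] -/
theorem continuous_jV : Continuous (jV A B) := (contMDiff_jV A B).continuous

/-- `ιK` is continuous. [folklore] -/
theorem continuous_ιK : Continuous (ιK A B) := (contMDiff_ιK A B).continuous

/-- **The glued space is compact** (it is covered by the images of the compact `V`, `K`).
[folklore] -/
instance compactSpace_Q : CompactSpace (Q A B) := by
  haveI : CompactSpace V := A.compactSpace
  haveI : CompactSpace K := B.compactSpace
  refine ⟨?_⟩
  rw [← range_jV_union_range_ιK A B]
  exact (isCompact_range (continuous_jV A B)).union (isCompact_range (continuous_ιK A B))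

/-- **`jV : V → Q` is a smooth embedding.** [folklore] -/
theorem isSmoothEmbedding_jV :
    Manifold.IsSmoothEmbedding (𝓡∂ (n + 1 + 1)) 𝓘(ℝ, 𝔼 (n + 1 + 1)) ∞ (jV A B) := by
  haveI : CompactSpace V := A.compactSpace
  exact ⟨Manifold.IsImmersionOfComplement.isImmersion fun v => isImmersionAtOfComplement_jV A B v,
    ((continuous_jV A B).isClosedEmbedding (injective_jV A B)).isEmbedding⟩

/-- **`ιK : K → Q` is a smooth embedding.** [folklore] -/
theorem isSmoothEmbedding_ιK :
    Manifold.IsSmoothEmbedding (𝓡∂ (n + 1 + 1)) 𝓘(ℝ, 𝔼 (n + 1 + 1)) ∞ (ιK A B) := by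
  haveI : CompactSpace K := B.compactSpace
  exact ⟨Manifold.IsImmersionOfComplement.isImmersion fun k => isImmersionAtOfComplement_ιK A B k,
    ((continuous_ιK A B).isClosedEmbedding (injective_ιK A B)).isEmbedding⟩

end Pieces

/-! ### The glued space as a gluing of `W` and `K` along `∂W ≡_ψ ∂K` -/

section GluingData

variable {n : ℕ} {W : Type u} [TopologicalSpace W] [ChartedSpace (ℍ (n + 1 + 1)) W]
  {C : Type u} [TopologicalSpace C] [ChartedSpace (ℍ (n + 1 + 1)) C]
  {M N : Type u} [TopologicalSpace M] [ChartedSpace (𝔼 (n + 1)) M]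
  [TopologicalSpace N] [ChartedSpace (𝔼 (n + 1)) N]
  {b : BoundaryData (𝓡∂ (n + 1 + 1)) W (𝓡 (n + 1))} {X : Cobordism (n + 1) M N}
  {ψ : b.carrier ≃ₘ⟮𝓡 (n + 1), 𝓡 (n + 1)⟯ M}
  {bC : BoundaryData (𝓡∂ (n + 1 + 1)) C (𝓡 (n + 1))} {ψ' : bC.carrier ≃ₘ⟮𝓡 (n + 1), 𝓡 (n + 1)⟯ N}
  {V : Type u} [TopologicalSpace V] [ChartedSpace (ℍ (n + 1 + 1)) V]
  {K : Type u} [TopologicalSpace K] [ChartedSpace (ℍ (n + 1 + 1)) K]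
  (A : CobordismAttachment b X ψ V) (B : CobordismAttachment bC X.symm ψ' K)
  [CompactSpace W] [CompactSpace C] [T2Space V] [T2Space K]
  [IsManifold (𝓡∂ (n + 1 + 1)) ∞ V] [IsManifold (𝓡∂ (n + 1 + 1)) ∞ K] [Nonempty X.W]

/-- **The piece `W` in the glued space**: `inl` of the lift of `jW` (the whole of `W` lies in
the interior of `V`). [folklore] -/
def jA (w : W) : Q A B :=
  (doubleGlueData A B).inl (InteriorManifold.lift A.jW A.isInteriorPoint_jW w)

/-- `jA w = jV (jW w)`. [folklore] -/
theorem jA_eq (w : W) : jA A B w = jV A B (A.jW w) := by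
  rw [jV_jW]; rfl

/-- `jA` is a smooth embedding. [folklore] -/
theorem isSmoothEmbedding_jA :
    Manifold.IsSmoothEmbedding (𝓡∂ (n + 1 + 1)) 𝓘(ℝ, 𝔼 (n + 1 + 1)) ∞ (jA A B) :=
  (doubleGlueData A B).isSmoothEmbedding_inl_comp (A.isSmoothEmbedding_jW.interiorLift _)

/-- The range of `jV` is covered by those of `jA` and `ιK`. [folklore] -/
theorem range_jV_subset : range (jV A B) ⊆ range (jA A B) ∪ range (ιK A B) := by
  rintro _ ⟨v, rfl⟩
  rcases A.exists_jW_eq_or v with ⟨w, rfl⟩ | ⟨x, rfl⟩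
  · exact Or.inl ⟨w, jA_eq A B w⟩
  · exact Or.inr ⟨B.jX x, (jV_jX_eq_ιK_jX A B x).symm⟩

/-- A point of `Q` off `range jV` is `ιK k` with `k` off the copy of `X`. [folklore] -/
theorem exists_eq_ιK_of_not_mem {q : Q A B} (hq : q ∉ range (jV A B)) :
    ∃ k, q = ιK A B k ∧ k ∉ range B.jX := by
  have hq' : q ∈ range (jV A B) ∪ range (ιK A B) := range_jV_union_range_ιK A B ▸ mem_univ q
  rcases hq' with h | ⟨k, rfl⟩
  · exact (hq h).elim
  · refine ⟨k, rfl, ?_⟩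
    rintro ⟨x, rfl⟩
    exact hq ⟨A.jX x, jV_jX_eq_ιK_jX A B x⟩

/-- `ιK k` lies in `range jV` iff `k` lies on the copy of `X`. [folklore] -/
theorem ιK_mem_range_jV_iff (k : K) : ιK A B k ∈ range (jV A B) ↔ k ∈ range B.jX := by
  constructor
  · rintro ⟨v, hv⟩
    obtain ⟨x, -, rfl⟩ := (jV_eq_ιK_iff A B).1 hv
    exact mem_range_self x
  · rintro ⟨x, rfl⟩
    exact ⟨A.jX x, jV_jX_eq_ιK_jX A B x⟩

variable [IsManifold (𝓡 (n + 1)) ∞ M]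

/-- **`Q` is the gluing of `W` and `K` along `∂W ≡_ψ ∂K`** (`∂K = jX̄ (inl M)`, boundary datum
`B.boundaryData` with carrier `M`): gluing data in the sense of `BoundaryGluingData`.
[cite: MilnorHCobordism1965, §1, Thm. 1.4] -/
def gluingData : BoundaryGluingData b B.boundaryData ψ.toEquiv (Q A B) where
  jA := jA A B
  jB := ιK A B
  isSmoothEmbedding_jA := isSmoothEmbedding_jA A B
  isSmoothEmbedding_jB := isSmoothEmbedding_ιK A B
  range_union := by
    apply eq_univ_of_univ_subset
    rw [← range_jV_union_range_ιK A B]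
    exact union_subset (range_jV_subset A B) subset_union_right
  jA_eq_jB_iff w k := by
    rw [jA_eq, jV_eq_ιK_iff]
    constructor
    · rintro ⟨x, hx, rfl⟩
      obtain ⟨z, rfl, rfl⟩ := (A.jW_eq_jX_iff w x).1 hx
      exact ⟨z, rfl, rfl⟩
    · rintro ⟨z, rfl, rfl⟩
      exact ⟨X.inl (ψ z), A.jW_incl z, rfl⟩

/-- The first piece of the gluing data is `jA` (definitional). [folklore] -/
@[simp] theorem gluingData_jA : (gluingData A B).jA = jA A B := rfl

/-- The second piece of the gluing data is `ιK` (definitional). [folklore] -/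
@[simp] theorem gluingData_jB : (gluingData A B).jB = ιK A B := rfl

end GluingData

/-! ### Uniqueness of the attachment relative to the far end -/

section Uniqueness

variable {n : ℕ} {W : Type u} [TopologicalSpace W] [ChartedSpace (ℍ (n + 1 + 1)) W]
  {M N : Type u} [TopologicalSpace M] [ChartedSpace (𝔼 (n + 1)) M]
  [TopologicalSpace N] [ChartedSpace (𝔼 (n + 1)) N]
  {b : BoundaryData (𝓡∂ (n + 1 + 1)) W (𝓡 (n + 1))} {X : Cobordism (n + 1) M N}
  {ψ : b.carrier ≃ₘ⟮𝓡 (n + 1), 𝓡 (n + 1)⟯ M}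
  {V₁ : Type u} [TopologicalSpace V₁] [ChartedSpace (ℍ (n + 1 + 1)) V₁]
  {V₂ : Type u} [TopologicalSpace V₂] [ChartedSpace (ℍ (n + 1 + 1)) V₂]

/-- **The degenerate case `X = ∅`**: then `V = jW (W)` and `jW` is a diffeomorphism `W ≅ V`.
[folklore] -/
def diffeomorphOfIsEmpty [IsManifold (𝓡∂ (n + 1 + 1)) ∞ W] [IsManifold (𝓡∂ (n + 1 + 1)) ∞ V₁]
    [IsEmpty X.W] (A : CobordismAttachment b X ψ V₁) : W ≃ₘ⟮𝓡∂ (n + 1 + 1), 𝓡∂ (n + 1 + 1)⟯ V₁ :=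
  have hsurj : Surjective A.jW := fun v => by
    rcases A.exists_jW_eq_or v with ⟨w, hw⟩ | ⟨x, -⟩
    · exact ⟨w, hw⟩
    · exact isEmptyElim x
  have hbij : Bijective A.jW := ⟨A.injective_jW, hsurj⟩
  { toEquiv := Equiv.ofBijective A.jW hbij
    contMDiff_toFun := A.isSmoothEmbedding_jW.contMDiff
    contMDiff_invFun := by
      have h := contMDiffOn_leftInverse_of_isImmersion A.isSmoothEmbedding_jW.isImmersion
        A.isSmoothEmbedding_jW.isEmbedding (Function.leftInverse_surjInv hbij)
      rw [hsurj.range_eq] at h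
      have h' : ContMDiff (𝓡∂ (n + 1 + 1)) (𝓡∂ (n + 1 + 1)) ∞ (Function.surjInv hsurj) :=
        fun v => (h v (mem_univ v)).contMDiffAt univ_mem
      refine h'.congr fun v => ?_
      apply hbij.1
      rw [Function.rightInverse_surjInv hsurj v]
      exact Equiv.ofBijective_apply_symm_apply A.jW hbij v }

/-- **Uniqueness of `W ∪_ψ X` relative to the far end (Milnor, *Lectures on the h-cobordism
theorem* (1965), Thm. 1.4, uniqueness half, for the triads `(W; ∅, ∂W)`, `(X; M, N)`).**  Any two
witnesses `V₁`, `V₂` of the attachment of the cobordism `X` to the compact manifold with boundary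
`W` along `ψ : ∂W ≅ M` are diffeomorphic by a diffeomorphism `θ` which, near the far end
`inr N` of `X` (that is, near `∂V₁`), is `jX₂ ∘ jX₁⁻¹` ON THE NOSE: `θ (jX₁ x) = jX₂ x` for all
`x` in an open neighbourhood of `inr N` in `X`.  Printed: the smooth structure on `W ∪_h W′` "is
unique up to a diffeomorphism leaving `V₀`, `h(V₁) = V₁′`, and `V₂′` fixed."  Proof: cap the far
ends by one and the same attachment `K = V₁ ∪_N X̄` (`exists_cobordismAttachment_holds`), glue
the interiors of `Vᵢ` and `K` along the interior of `X` into closed manifolds `Qᵢ` which are both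
gluings of `W` and `K` along `∂W ≡_ψ ∂K` (`gluingData`), compare them by the uniqueness of
gluings controlled off a neighbourhood of `∂K` (`GluingUniquenessControlled.lean`, Hirsch (1976),
Ch. 8, Thm. 2.1), and restrict to the copies of `V₁`, `V₂`.
[cite: MilnorHCobordism1965, §1, Thm. 1.4] -/
theorem exists_diffeomorph_eq_jX_near_inr [T2Space W] [IsManifold (𝓡∂ (n + 1 + 1)) ∞ W]
    [CompactSpace W] [IsManifold (𝓡 (n + 1)) ∞ M] [IsManifold (𝓡 (n + 1)) ∞ N]
    [T2Space V₁] [SecondCountableTopology V₁] [IsManifold (𝓡∂ (n + 1 + 1)) ∞ V₁]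
    [T2Space V₂] [IsManifold (𝓡∂ (n + 1 + 1)) ∞ V₂]
    (A₁ : CobordismAttachment b X ψ V₁) (A₂ : CobordismAttachment b X ψ V₂) :
    ∃ θ : V₁ ≃ₘ⟮𝓡∂ (n + 1 + 1), 𝓡∂ (n + 1 + 1)⟯ V₂, ∃ U : Set X.W, IsOpen U ∧ range X.inr ⊆ U ∧
      ∀ x ∈ U, θ (A₁.jX x) = A₂.jX x := by
  haveI : CompactSpace V₁ := A₁.compactSpace
  haveI : CompactSpace V₂ := A₂.compactSpace
  rcases isEmpty_or_nonempty X.W with hE | hNE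
  · exact ⟨(diffeomorphOfIsEmpty A₁).symm.trans (diffeomorphOfIsEmpty A₂), univ, isOpen_univ,
      subset_univ _, fun x _ => isEmptyElim x⟩
  -- the common cap `K = V₁ ∪_N X̄`
  obtain ⟨K, _, _, _, _, _, ⟨B⟩⟩ := exists_cobordismAttachment_holds n V₁ A₁.boundaryData N M
    X.symm (Diffeomorph.refl (𝓡 (n + 1)) N ∞)
  haveI : CompactSpace K := B.compactSpace
  haveI : CompactSpace M := X.compactSpace_of_inl
  haveI : CompactSpace N := X.compactSpace_of_inr
  -- disjoint open neighbourhoods of the two ends of `X`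
  obtain ⟨O₁, O₂, hO₁, hO₂, hl, hr, hd⟩ := SeparatedNhds.of_isCompact_isCompact
    (X.isClosed_range_inl.isCompact) (X.symm.isClosed_range_inl.isCompact) X.disjoint_range
  -- the controlled comparison of the two closed gluings
  set G₁ := gluingData A₁ B with hG₁
  set G₂ := gluingData A₂ B with hG₂
  have hO' : IsOpen (B.jX '' O₁) :=
    B.isOpen_image_jX_of_subset (X := X.symm) hO₁
      (Set.disjoint_left.2 fun x hx hx' => Set.disjoint_left.1 hd hx (hr hx'))
  have hOb : range B.boundaryData.incl ⊆ B.jX '' O₁ := by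
    rintro _ ⟨m, rfl⟩
    exact ⟨X.inl m, hl (mem_range_self m), rfl⟩
  obtain ⟨Ψ, -, hΨ⟩ := G₁.exists_diffeomorph_apply_jA_eq G₂ isOpen_univ (subset_univ _) hO' hOb
  simp only [hG₁, hG₂, gluingData_jB] at hΨ
  -- `Ψ` is `ιK₂ ∘ ιK₁⁻¹` off `jX̄ (O₁)`, in particular on `jX̄ (O₂)` and off `range jX̄`
  have hΨX : ∀ x ∈ O₂, Ψ (jV A₁ B (A₁.jX x)) = jV A₂ B (A₂.jX x) := by
    intro x hx
    rw [jV_jX_eq_ιK_jX, jV_jX_eq_ιK_jX]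
    refine hΨ (B.jX x) ?_
    rintro ⟨x', hx', hxx'⟩
    rw [B.injective_jX hxx'] at hx'
    exact Set.disjoint_left.1 hd hx' hx
  have hΨout : ∀ q, q ∉ range (jV A₁ B) → Ψ q ∉ range (jV A₂ B) := by
    intro q hq
    obtain ⟨k, rfl, hk⟩ := exists_eq_ιK_of_not_mem A₁ B hq
    rw [hΨ k (fun h => hk (image_subset_range _ _ h)), ιK_mem_range_jV_iff]
    exact hk
  have hΨout' : ∀ q, q ∉ range (jV A₂ B) → Ψ.symm q ∉ range (jV A₁ B) := by
    intro q hq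
    obtain ⟨k, rfl, hk⟩ := exists_eq_ιK_of_not_mem A₂ B hq
    have : Ψ.symm (ιK A₂ B k) = ιK A₁ B k := by
      rw [← hΨ k (fun h => hk (image_subset_range _ _ h)), Diffeomorph.symm_apply_apply]
    rw [this, ιK_mem_range_jV_iff]
    exact hk
  have hΨin : ∀ v, Ψ (jV A₁ B v) ∈ range (jV A₂ B) := by
    intro v
    by_contra h
    have := hΨout' _ h
    rw [Diffeomorph.symm_apply_apply] at this
    exact this (mem_range_self v)
  have hΨin' : ∀ v, Ψ.symm (jV A₂ B v) ∈ range (jV A₁ B) := by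
    intro v
    by_contra h
    have := hΨout _ h
    rw [Diffeomorph.apply_symm_apply] at this
    exact this (mem_range_self v)
  -- the restriction `θ = jV₂⁻¹ ∘ Ψ ∘ jV₁`
  haveI : Nonempty V₁ := ⟨A₁.jX (Classical.arbitrary _)⟩
  haveI : Nonempty V₂ := ⟨A₂.jX (Classical.arbitrary _)⟩
  set i₁ := Function.invFun (jV A₁ B) with hi₁
  set i₂ := Function.invFun (jV A₂ B) with hi₂
  have hi₁s : ContMDiffOn 𝓘(ℝ, 𝔼 (n + 1 + 1)) (𝓡∂ (n + 1 + 1)) ∞ i₁ (range (jV A₁ B)) :=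
    contMDiffOn_leftInverse_of_isImmersion (isSmoothEmbedding_jV A₁ B).isImmersion
      (isSmoothEmbedding_jV A₁ B).isEmbedding (Function.leftInverse_invFun (injective_jV A₁ B))
  have hi₂s : ContMDiffOn 𝓘(ℝ, 𝔼 (n + 1 + 1)) (𝓡∂ (n + 1 + 1)) ∞ i₂ (range (jV A₂ B)) :=
    contMDiffOn_leftInverse_of_isImmersion (isSmoothEmbedding_jV A₂ B).isImmersion
      (isSmoothEmbedding_jV A₂ B).isEmbedding (Function.leftInverse_invFun (injective_jV A₂ B))
  have hi₁ : ∀ v, i₁ (jV A₁ B v) = v := Function.leftInverse_invFun (injective_jV A₁ B)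
  have hi₂ : ∀ v, i₂ (jV A₂ B v) = v := Function.leftInverse_invFun (injective_jV A₂ B)
  have hji₁ : ∀ q ∈ range (jV A₁ B), jV A₁ B (i₁ q) = q := fun q hq => Function.invFun_eq hq
  have hji₂ : ∀ q ∈ range (jV A₂ B), jV A₂ B (i₂ q) = q := fun q hq => Function.invFun_eq hq
  let θ : V₁ ≃ₘ⟮𝓡∂ (n + 1 + 1), 𝓡∂ (n + 1 + 1)⟯ V₂ :=
    { toFun := fun v => i₂ (Ψ (jV A₁ B v))
      invFun := fun v => i₁ (Ψ.symm (jV A₂ B v))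
      left_inv := fun v => by
        show i₁ (Ψ.symm (jV A₂ B (i₂ (Ψ (jV A₁ B v))))) = v
        rw [hji₂ _ (hΨin v), Diffeomorph.symm_apply_apply, hi₁]
      right_inv := fun v => by
        show i₂ (Ψ (jV A₁ B (i₁ (Ψ.symm (jV A₂ B v))))) = v
        rw [hji₁ _ (hΨin' v), Diffeomorph.apply_symm_apply, hi₂]
      contMDiff_toFun :=
        hi₂s.comp_contMDiff (Ψ.contMDiff.comp (contMDiff_jV A₁ B)) fun v => hΨin v
      contMDiff_invFun :=
        hi₁s.comp_contMDiff (Ψ.symm.contMDiff.comp (contMDiff_jV A₂ B)) fun v => hΨin' v }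
  refine ⟨θ, O₂, hO₂, hr, fun x hx => ?_⟩
  show i₂ (Ψ (jV A₁ B (A₁.jX x))) = A₂.jX x
  rw [hΨX x hx, hi₂]

end Uniqueness


end CobordismAttachment

end Literature.Topology.FourManifolds

end
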